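import Literature.NumberTheory.GaloisRepresentations.ArtinCharacterReciprocityProofs
import Literature.NumberTheory.GaloisRepresentations.ArtinReciprocityCyclic
import Literature.NumberTheory.GaloisRepresentations.KummerUnramifiedUnit
import Literature.NumberTheory.GaloisRepresentations.CyclotomicFrobenius
import Literature.NumberTheory.GaloisRepresentations.CubicJacobiSumPrimary
import Mathlib.FieldTheory.KummerExtension
import HarnessLib

/-!
# Periodicity of the cubic residue symbol `𝔭 ↦ χ_𝔭(D)` modulo `9D`, from Kummer theory and the
# tree's Artin reciprocity law

Topic `NumberTheory/GaloisRepresentations`; namespace `Literature.NumberTheory.GaloisRepresentations`.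
Definitions with bodies (`cubeRoot`, `kummerField = K⟮∛D⟯ ⊆ K̄`, `cubeRootL`, `cubeRootInt`,
`kummerChar`, the auxiliary iteration `cubeIter`) and theorems; no named fact (D-0026). Filed in
support of the named fact `murty_petersson_newform_lower_bound` (the `j = 0` CM family needs the
Grössencharacter `𝔭 ↦ χ_𝔭(Δ)ϖ²` of `ℚ(ω)` to be PERIODIC, `ComplexMultiplicationDeuring0Square`),
and of independent interest: it is the law of cubic reciprocity in its "existence of a conductor"
form (Ireland–Rosen Ch. 9 Thm. 1 with Eisenstein's supplement), obtained here not from Gauss sums but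
from class field theory, which the tree PROVES (`ArtinCharacterReciprocityProofs`).

Let `K` be a number field with `ζ₃ ∈ 𝓞 K` (`IsCyclotomicExtension {3} ℚ K` is NOT assumed except
that `K` is then totally complex), `D ∈ 𝓞 K` not a cube in `K`, `L = K(∛D) ⊆ K̄` and `e : K →+* ℂ`.

* `kummerField`, instances `FiniteDimensional`, `NumberField`; `finrank_kummerField` (`[L:K] = 3`),
  `isSplittingField_kummerField`, `isGalois_kummerField`, `isCyclic_gal_kummerField` (Mathlib's Kummer
  theory `FieldTheory/KummerExtension`);
* `kummerChar hζ hD e : Gal(L/K) →* ℂˣ`, `σ ↦ e(σ(∛D)/∛D)` (Mathlib `autEquivRootsOfUnity`),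
  `kummerChar_spec`, `kummerChar_pow_three`;
* `kummerChar_galFrob` — **`kummerChar(Frob_v) = e(χ_v(D))` for `v ∤ 3D`** (Euler's criterion in
  `𝓞_L/𝔔` for the chosen Frobenius `galFrob` of `CyclotomicFrobenius`: `Frob(∛D) ≡ (∛D)^{Nv}`,
  `(∛D)^{Nv} = D^{(Nv−1)/3}∛D`, `∛D ∉ 𝔔`, and Ireland–Rosen Prop. 9.3.2
  `cubicResidueSymbol_eq_of_pow_three_eq_one`);
* `isUnramifiedIn_kummerField` (`v ∤ 3D` unramified, `KummerUnramifiedUnit`) and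
  `exists_artinKillsRay_kummerChar` — **Artin reciprocity** for the cyclic cubic extension `L/K`
  (`artinKillsRay_of_finrank_le_relIndex` + `IdeleHerbrand.globalCyclicNormIndex`): a modulus `𝔪 ≠ 0`
  supported on the primes of `3D` whose ray is killed by the Artin symbol of `v ↦ kummerChar(Frob_v)`;
* `exists_pow_three_sub_mem_of_pow_mem` — the **cube lemma**: in any commutative ring, if `(3D)^e ∈ I`
  then `1 + 9Ds ≡ γ³ (mod I)` (global `(3D)`-adic contraction `z ↦ Ds − 3z² − 3z³`, no Hensel prime by
  prime), which converts the inexplicit CFT modulus into the explicit one: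
* `artinSymbol_kummerChar_eq_of_sub_mem_span` — **periodicity modulo `9D`**: for nonzero
  `b ≡ c (mod 9D)` with `c` prime to `3D`, the Artin symbols `∏_v kummerChar(Frob_v)^{ord_v}` of `(b)`
  and `(c)` coincide (an order-`3` character is trivial on `1 + 9D𝓞` modulo `𝔪`);
* `artinSymbol_kummerChar_asIdeal` (value `e(χ_v(D))` at `v ∤ 3D`), `artinSymbol_pow_three_eq_one`,
  `cubicResidueSymbol_eq_one_of_cube` (the excluded case `D = b³`), `isEmpty_ringHom_real`.

## References

* N. Childress, *Class Field Theory*, Universitext (2009), Ch. 5 §2 Thm. 2.1 (Artin reciprocity for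
  cyclic extensions) — as proved in the tree. [cite: Childress2009, Ch. 5 §2 Thm. 2.1]
* K. Ireland, M. Rosen, *A Classical Introduction to Modern Number Theory*, 2nd ed. (1990), Ch. 9 §3
  (Prop. 9.3.2–9.3.3, Theorem 1 and 1'), Ch. 14 §2 (power residue symbol = Frobenius on `ⁿ√a`).
  [cite: IrelandRosen1990, Ch. 9 §3 Theorem 1]
* J. Neukirch, *Class Field Theory — The Bonn Lectures* (2013), Part III Thm. (7.7) (Kummer
  extensions by units are unramified outside `n·a`). [cite: Neukirch2013, Part III Thm. (7.7)]

## Mathlib / tree search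

Tree: `galFrob`, `galFrob_spec` (`CyclotomicFrobenius`); `artinKillsRay_of_finrank_le_relIndex`
(`ArtinReciprocityCyclic`); `IdeleHerbrand.globalCyclicNormIndex` (`ArtinCharacterReciprocityProofs`);
`isUnramifiedIn_adjoin_root` (`KummerUnramifiedUnit`); `LFunctions.AbelianDensity.artinSymbol`,
`artinSymbol_asIdeal`, `artinSymbol_mul`, `ArtinKillsRay` (`AbelianFrobeniusDensity`);
`cubicResidueSymbol`, `cubicResidueChar`, `cubicResidueSymbol_spec`,
`cubicResidueSymbol_eq_of_pow_three_eq_one`, `three_dvd_residueCard_sub_one` (`CubicResidueSymbol`);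
`isPrimitiveRoot_coe_three`, `sq_add_self_add_one_eq_zero` (`CubicJacobiSumPrimary`/`CubicResidueSymbol`).
Mathlib: `IntermediateField.adjoin`, `adjoin.finrank`, `adjoin.powerBasis`,
`X_pow_sub_C_irreducible_of_prime`, `isSplittingField_X_pow_sub_C_of_root_adjoin_eq_top`,
`isGalois_of_isSplittingField_X_pow_sub_C`, `isCyclic_of_isSplittingField_X_pow_sub_C`,
`autEquivRootsOfUnity`, `autEquivRootsOfUnity_smul`, `IsArithFrobAt`, `Ideal.radical_eq_sInf`,
`Ideal.exists_le_maximal`, `IsAlgClosed.exists_pow_nat_eq`. `lean search 'kummerChar|cubeRoot|Periodicity'`: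
no prior hits.
-/

noncomputable section

open NumberField IsDedekindDomain Polynomial IntermediateField

open scoped Classical

universe u

namespace Literature.NumberTheory.GaloisRepresentations

/-! ### The Kummer extension `L = K(∛D)` inside `K̄` -/

section Kummer

variable {K : Type u} [Field K]

/-- A chosen cube root of `D` in the algebraic closure. [folklore] -/
def cubeRoot (D : 𝓞 K) : AlgebraicClosure K :=
  (IsAlgClosed.exists_pow_nat_eq (algebraMap K (AlgebraicClosure K) (D : K)) (by norm_num : 0 < 3)).choose

/-- `(∛D)³ = D`. [folklore] -/
theorem cubeRoot_pow_three (D : 𝓞 K) :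
    cubeRoot D ^ 3 = algebraMap K (AlgebraicClosure K) (D : K) :=
  (IsAlgClosed.exists_pow_nat_eq (algebraMap K (AlgebraicClosure K) (D : K)) (by norm_num : 0 < 3)).choose_spec

/-- The Kummer field `L = K(∛D) ⊆ K̄` (as an intermediate field of the algebraic closure). [folklore] -/
abbrev kummerField (D : 𝓞 K) : IntermediateField K (AlgebraicClosure K) := K⟮cubeRoot D⟯

/-- `∛D` as an element of `L`. [folklore] -/
def cubeRootL (D : 𝓞 K) : kummerField D := ⟨cubeRoot D, mem_adjoin_simple_self K (cubeRoot D)⟩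

/-- `(∛D)³ = D` in `L`. [folklore] -/
theorem cubeRootL_pow_three (D : 𝓞 K) :
    cubeRootL D ^ 3 = algebraMap K (kummerField D) (D : K) := by
  apply Subtype.ext
  exact cubeRoot_pow_three D

/-- `∛D` is integral over `K`. [folklore] -/
theorem isIntegral_cubeRoot (D : 𝓞 K) : IsIntegral K (cubeRoot D) :=
  Algebra.IsIntegral.isIntegral _

/-- `L/K` is finite. [folklore] -/
instance finiteDimensional_kummerField (D : 𝓞 K) : FiniteDimensional K (kummerField D) :=
  adjoin.finiteDimensional (isIntegral_cubeRoot D)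

variable [NumberField K]

/-- `L` is a number field. [folklore] -/
instance numberField_kummerField (D : 𝓞 K) : NumberField (kummerField D) := by
  haveI : CharZero (kummerField D) := charZero_of_injective_algebraMap (algebraMap K _).injective
  haveI : FiniteDimensional ℚ (kummerField D) := FiniteDimensional.trans ℚ K (kummerField D)
  exact ⟨⟩

omit [NumberField K] in
/-- `∛D` is the canonical generator of `L`. [folklore] -/
theorem cubeRootL_eq_gen (D : 𝓞 K) : cubeRootL D = AdjoinSimple.gen K (cubeRoot D) := rfl

omit [NumberField K] in
/-- `K⟮∛D⟯ = ⊤` inside `L`. [folklore] -/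
theorem adjoin_cubeRootL_eq_top (D : 𝓞 K) : K⟮cubeRootL D⟯ = ⊤ := by
  apply adjoin_eq_top_of_algebra
  have h := (adjoin.powerBasis (isIntegral_cubeRoot D)).adjoin_gen_eq_top
  rwa [adjoin.powerBasis_gen, ← cubeRootL_eq_gen] at h


variable {ζ : 𝓞 K} (hζ : IsPrimitiveRoot ζ 3) {D : 𝓞 K}

include hζ in
omit [NumberField K] in
/-- `K` contains a primitive cube root of unity. [folklore] -/
theorem primitiveRoots_three_nonempty : (primitiveRoots 3 K).Nonempty :=
  ⟨(ζ : K), (mem_primitiveRoots (by norm_num)).mpr (isPrimitiveRoot_coe_three hζ)⟩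

omit [NumberField K] in
/-- `X³ − D` is irreducible over `K` when `D` is not a cube in `K`. [folklore] -/
theorem irreducible_X_pow_three_sub_C (hD : ∀ b : K, b ^ 3 ≠ (D : K)) :
    Irreducible (X ^ 3 - C (D : K)) :=
  X_pow_sub_C_irreducible_of_prime Nat.prime_three hD

omit [NumberField K] in
/-- The minimal polynomial of `∛D` is `X³ − D`. [folklore] -/
theorem minpoly_cubeRoot (hD : ∀ b : K, b ^ 3 ≠ (D : K)) : minpoly K (cubeRoot D) = X ^ 3 - C (D : K) := by
  refine (minpoly.eq_of_irreducible_of_monic (irreducible_X_pow_three_sub_C hD) ?_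
    (monic_X_pow_sub_C _ three_ne_zero)).symm
  simp [cubeRoot_pow_three]

omit [NumberField K] in
/-- `[L : K] = 3`. [folklore] -/
theorem finrank_kummerField (hD : ∀ b : K, b ^ 3 ≠ (D : K)) : Module.finrank K (kummerField D) = 3 := by
  rw [adjoin.finrank (isIntegral_cubeRoot D), minpoly_cubeRoot hD, natDegree_X_pow_sub_C]

include hζ in
omit [NumberField K] in
/-- `L = K(∛D)` is a splitting field of `X³ − D` (`K ∋ ζ₃`). [folklore] -/
theorem isSplittingField_kummerField (hD : ∀ b : K, b ^ 3 ≠ (D : K)) :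
    IsSplittingField K (kummerField D) (X ^ 3 - C (D : K)) := by
  have h3 := finrank_kummerField hD
  have h := isSplittingField_X_pow_sub_C_of_root_adjoin_eq_top (K := K) (L := kummerField D)
    (by rw [h3]; exact primitiveRoots_three_nonempty hζ) (a := (D : K)) (α := cubeRootL D)
    (by rw [h3]; exact cubeRootL_pow_three D) (adjoin_cubeRootL_eq_top D)
  rwa [h3] at h

include hζ in
omit [NumberField K] in
/-- `L/K` is Galois. [folklore] -/
theorem isGalois_kummerField (hD : ∀ b : K, b ^ 3 ≠ (D : K)) : IsGalois K (kummerField D) := by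
  haveI := isSplittingField_kummerField hζ hD
  exact isGalois_of_isSplittingField_X_pow_sub_C (primitiveRoots_three_nonempty hζ)
    (irreducible_X_pow_three_sub_C hD) (kummerField D)

include hζ in
omit [NumberField K] in
/-- `Gal(L/K)` is cyclic (of order `3`). [folklore] -/
theorem isCyclic_gal_kummerField (hD : ∀ b : K, b ^ 3 ≠ (D : K)) :
    IsCyclic (kummerField D ≃ₐ[K] kummerField D) := by
  haveI := isSplittingField_kummerField hζ hD
  exact isCyclic_of_isSplittingField_X_pow_sub_C (primitiveRoots_three_nonempty hζ)
    (irreducible_X_pow_three_sub_C hD) (kummerField D)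

/-! ### The Kummer character `σ ↦ σ(∛D)/∛D` and its value on Frobenius elements -/

/-- **The Kummer character** of `Gal(K(∛D)/K)` with values in `ℂˣ`: `σ ↦ e(σ(∛D)/∛D)` for a ring
homomorphism `e : K →+* ℂ` (Mathlib's `autEquivRootsOfUnity`, which does not depend on the choice of
the cube root, followed by `e` on `μ₃(K)`). [folklore] -/
def kummerChar (hD : ∀ b : K, b ^ 3 ≠ (D : K)) (e : K →+* ℂ) :
    (kummerField D ≃ₐ[K] kummerField D) →* ℂˣ :=
  haveI := isSplittingField_kummerField hζ hD
  (Units.map (e : K →* ℂ)).comp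
    (((rootsOfUnity 3 K).subtype).comp
      (autEquivRootsOfUnity (primitiveRoots_three_nonempty hζ) (irreducible_X_pow_three_sub_C hD)
        (kummerField D)).toMonoidHom)

omit [NumberField K] in
/-- The defining property: `σ(∛D) = u • ∛D` with `kummerChar σ = e(u)`, `u ∈ μ₃(K)`. [folklore] -/
theorem kummerChar_spec (hD : ∀ b : K, b ^ 3 ≠ (D : K)) (e : K →+* ℂ)
    (σ : kummerField D ≃ₐ[K] kummerField D) :
    ∃ u : Kˣ, u ∈ rootsOfUnity 3 K ∧ (kummerChar hζ hD e σ : ℂ) = e u ∧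
      σ (cubeRootL D) = (u : K) • cubeRootL D := by
  haveI := isSplittingField_kummerField hζ hD
  set E := autEquivRootsOfUnity (primitiveRoots_three_nonempty hζ) (irreducible_X_pow_three_sub_C hD)
    (kummerField D) with hE
  refine ⟨(E σ : Kˣ), (E σ).2, rfl, ?_⟩
  have h := autEquivRootsOfUnity_smul (primitiveRoots_three_nonempty hζ)
    (irreducible_X_pow_three_sub_C hD) (kummerField D) (cubeRootL_pow_three D) σ
  rw [← h]
  rfl


omit [NumberField K] in
/-- The values of the Kummer character are cube roots of unity: `(kummerChar σ)³ = 1`. [folklore] -/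
theorem kummerChar_pow_three (hD : ∀ b : K, b ^ 3 ≠ (D : K)) (e : K →+* ℂ)
    (σ : kummerField D ≃ₐ[K] kummerField D) : kummerChar hζ hD e σ ^ 3 = 1 := by
  obtain ⟨u, hu3, hval, -⟩ := kummerChar_spec hζ hD e σ
  ext
  rw [Units.val_pow_eq_pow_val, hval, ← map_pow, Units.val_one]
  have : ((u : Kˣ) : K) ^ 3 = 1 := by
    have h := (mem_rootsOfUnity' 3 u).mp hu3
    exact h
  rw [this, map_one]

omit [NumberField K] in
/-- `∛D ∈ L` is an algebraic integer. [folklore] -/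
theorem isIntegral_cubeRootL (D : 𝓞 K) : IsIntegral ℤ (cubeRootL D : kummerField D) := by
  refine IsIntegral.of_pow (by norm_num : 0 < 3) ?_
  rw [cubeRootL_pow_three]
  exact (RingOfIntegers.isIntegral_coe D).algebraMap

/-- `∛D` as an element of `𝓞 L`. [folklore] -/
def cubeRootInt (D : 𝓞 K) : 𝓞 (kummerField D) := ⟨cubeRootL D, isIntegral_cubeRootL D⟩

omit [NumberField K] in
/-- `(∛D)³ = D` in `𝓞 L`. [folklore] -/
theorem cubeRootInt_pow_three (D : 𝓞 K) :
    cubeRootInt D ^ 3 = algebraMap (𝓞 K) (𝓞 (kummerField D)) D := by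
  apply RingOfIntegers.ext
  show cubeRootL D ^ 3 = algebraMap K (kummerField D) (D : K)
  exact cubeRootL_pow_three D

include hζ in
/-- **The Kummer character on a Frobenius element is the cubic residue symbol**: for a prime
`v ∤ 3D` of `K`, `kummerChar(Frob_v) = e(χ_v(D))` — Euler's criterion in `𝓞_L/𝔔`:
`Frob_v(∛D) ≡ (∛D)^{Nv} = D^{(Nv−1)/3} ∛D (mod 𝔔)` and `∛D ∉ 𝔔`, so the cube root of unity
`Frob_v(∛D)/∛D` is `≡ D^{(Nv−1)/3} (mod v)`, i.e. it is `χ_v(D)` (Ireland–Rosen Prop. 9.3.2).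
[cite: IrelandRosen1990, Ch. 9 §3 Prop. 9.3.2; Ch. 14 §2] -/
theorem kummerChar_galFrob (hD : ∀ b : K, b ^ 3 ≠ (D : K)) (e : K →+* ℂ)
    [IsGalois K (kummerField D)] (v : HeightOneSpectrum (𝓞 K)) (hDv : D ∉ v.asIdeal)
    (h3v : (3 : 𝓞 K) ∉ v.asIdeal) :
    (kummerChar hζ hD e (galFrob K (kummerField D) v) : ℂ) =
      e (cubicResidueSymbol v (Ideal.Quotient.mk v.asIdeal D) : K) := by
  set N := kummerField D
  obtain ⟨u, hu3, hval, hsmul⟩ := kummerChar_spec hζ hD e (galFrob K N v)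
  obtain ⟨Q, hQ, hφ⟩ := galFrob_spec K N v
  haveI := hQ.1
  have hover : v.asIdeal = Q.under (𝓞 K) := hQ.2.over
  -- `u = ζ^i` is an integer of `K`
  have hζK : IsPrimitiveRoot ((ζ : 𝓞 K) : K) 3 := isPrimitiveRoot_coe_three hζ
  obtain ⟨i, -, hi⟩ := hζK.eq_pow_of_pow_eq_one ((mem_rootsOfUnity' 3 u).mp hu3)
  obtain ⟨μ, hμ⟩ : ∃ μ : 𝓞 K, μ = ζ ^ i := ⟨_, rfl⟩
  have hμK : (μ : K) = (u : K) := by rw [hμ]; push_cast; exact hi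
  have hμ3 : μ ^ 3 = 1 := by
    rw [hμ, ← pow_mul, mul_comm, pow_mul, hζ.pow_eq_one, one_pow]
  -- the Frobenius congruence for `α = ∛D ∈ 𝓞 L`
  set α := cubeRootInt D with hα
  have hgal : galFrob K N v • α = algebraMap (𝓞 K) (𝓞 N) μ * α := by
    apply RingOfIntegers.ext
    show (galFrob K N v) (cubeRootL D) = ((μ : K) : N) * cubeRootL D
    rw [hsmul, hμK, Algebra.smul_def]
    rfl
  set q := Nat.card (𝓞 K ⧸ Q.under (𝓞 K)) with hq
  have hqv : q = v.residueCard := by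
    rw [hq, ← hover, HeightOneSpectrum.residueCard_eq_card_quotient]
  have hF : galFrob K N v • α - α ^ q ∈ Q := by
    have h := hφ α
    rwa [MulSemiringAction.toAlgHom_apply] at h
  -- `α^q = α D^{(q-1)/3}`
  obtain ⟨m, hm⟩ : 3 ∣ q - 1 := by rw [hqv]; exact three_dvd_residueCard_sub_one hζ h3v
  have hq1 : 1 ≤ q := by
    rw [hqv, HeightOneSpectrum.residueCard_eq_card_quotient]
    haveI : Finite (𝓞 K ⧸ v.asIdeal) := Ideal.finiteQuotientOfFreeOfNeBot v.asIdeal v.ne_bot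
    exact Nat.card_pos
  have hαq : α ^ q = α * algebraMap (𝓞 K) (𝓞 N) D ^ m := by
    have : q = 3 * m + 1 := by omega
    rw [this, pow_succ, pow_mul, cubeRootInt_pow_three, mul_comm]
  -- `α (μ - D^m) ∈ Q`, `α ∉ Q`
  have hmem : α * algebraMap (𝓞 K) (𝓞 N) (μ - D ^ m) ∈ Q := by
    have e1 : α * algebraMap (𝓞 K) (𝓞 N) (μ - D ^ m) = galFrob K N v • α - α ^ q := by
      rw [hgal, hαq, map_sub, map_pow]; ring
    rw [e1]; exact hF
  have hαQ : α ∉ Q := by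
    intro h
    have h3 : α ^ 3 ∈ Q := Q.pow_mem_of_mem h 3 (by norm_num)
    rw [cubeRootInt_pow_three] at h3
    apply hDv
    rw [hover, Ideal.under_def, Ideal.mem_comap]
    exact h3
  have hK : μ - D ^ m ∈ v.asIdeal := by
    rw [hover, Ideal.under_def, Ideal.mem_comap]
    exact ((hQ.1.mem_or_mem hmem).resolve_left hαQ)
  -- conclude with Ireland–Rosen's characterisation
  have hm' : m = (v.residueCard - 1) / 3 := by rw [← hqv]; omega
  have hsymb : cubicResidueSymbol v (Ideal.Quotient.mk v.asIdeal D) = μ := by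
    refine cubicResidueSymbol_eq_of_pow_three_eq_one hζ h3v hμ3 ?_
    rw [← hm', ← map_pow, eq_comm, ← sub_eq_zero, ← map_sub, Ideal.Quotient.eq_zero_iff_mem]
    have : D ^ m - μ = -(μ - D ^ m) := by ring
    rw [this]
    exact v.asIdeal.neg_mem hK
  rw [hval, hsymb, hμK]


/-! ### Artin reciprocity: the Kummer character of Frobenius kills a ray -/

omit [NumberField K] in
/-- `(∛D)³ = D` in `K̄` with `D` read in `𝓞 K`. [folklore] -/
theorem cubeRoot_pow_three' (D : 𝓞 K) :
    cubeRoot D ^ 3 = algebraMap (𝓞 K) (AlgebraicClosure K) D := by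
  rw [cubeRoot_pow_three, IsScalarTower.algebraMap_apply (𝓞 K) K]

include hζ in
/-- **`K(∛D)/K` is unramified at every prime `v ∤ 3D`** (`KummerUnramifiedUnit.isUnramifiedIn_adjoin_root`).
[cite: Neukirch2013, Part III Thm. (7.7) (proof)] -/
theorem isUnramifiedIn_kummerField (v : HeightOneSpectrum (𝓞 K)) (hDv : D ∉ v.asIdeal)
    (h3v : (3 : 𝓞 K) ∉ v.asIdeal) : Algebra.IsUnramifiedIn (𝓞 (kummerField D)) v.asIdeal :=
  isUnramifiedIn_adjoin_root (d := 3) (by norm_num) (isPrimitiveRoot_coe_three hζ) v hDv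
    (by exact_mod_cast h3v) (cubeRoot_pow_three' D)

include hζ in
/-- **Artin reciprocity for the Kummer character** (the tree's `artinKillsRay_of_finrank_le_relIndex`
with the global cyclic norm index inequality `IdeleHerbrand.globalCyclicNormIndex`): there is a
modulus `𝔪 ≠ 0`, all of whose prime divisors contain `3D`, such that the Artin symbol of
`v ↦ kummerChar(Frob_v)` kills the ray modulo `𝔪`. [cite: Childress2009, Ch. 5 §2 Thm. 2.1] -/
theorem exists_artinKillsRay_kummerChar (hD : ∀ b : K, b ^ 3 ≠ (D : K)) (e : K →+* ℂ)
    [IsGalois K (kummerField D)] :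
    ∃ 𝔪 : Ideal (𝓞 K), 𝔪 ≠ ⊥ ∧ (∀ v : HeightOneSpectrum (𝓞 K), 𝔪 ≤ v.asIdeal → 3 * D ∈ v.asIdeal) ∧
      LFunctions.AbelianDensity.ArtinKillsRay 𝔪
        (fun v ↦ kummerChar hζ hD e (galFrob K (kummerField D) v)) := by
  haveI := isCyclic_gal_kummerField hζ hD
  obtain ⟨𝔪, h𝔪, hiff, hindex⟩ := IdeleHerbrand.globalCyclicNormIndex K (kummerField D)
  refine ⟨𝔪, h𝔪, fun v hv ↦ ?_, artinKillsRay_of_finrank_le_relIndex h𝔪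
    (fun v hv ↦ not_not.mp fun h ↦ hv ((hiff v).mpr h)) hindex _⟩
  by_contra h3D
  exact (hiff v).mp hv (isUnramifiedIn_kummerField hζ v
    (fun hD' ↦ h3D (v.asIdeal.mul_mem_left _ hD')) (fun h3 ↦ h3D (v.asIdeal.mul_mem_right _ h3)))

/-! ### Cube roots of `1 + 9Ds` modulo an ideal containing a power of `3D` -/

section CubeLemma

variable {R : Type*} [CommRing R]

/-- The Newton-type iteration `z_{k+1} = Ds − 3z_k² − 3z_k³`, `z₀ = 0`. [folklore] -/
def cubeIter (D s : R) : ℕ → R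
  | 0 => 0
  | k + 1 => D * s - 3 * cubeIter D s k ^ 2 - 3 * cubeIter D s k ^ 3

/-- Every iterate is a multiple of `D`. [folklore] -/
theorem cubeIter_dvd (D s : R) : ∀ k : ℕ, ∃ w : R, cubeIter D s k = D * w := by
  intro k
  induction k with
  | zero => exact ⟨0, by simp [cubeIter]⟩
  | succ k ih =>
    obtain ⟨w, hw⟩ := ih
    exact ⟨s - 3 * D * w ^ 2 - 3 * D ^ 2 * w ^ 3, by simp only [cubeIter, hw]; ring⟩

/-- Consecutive iterates differ by a multiple of `(3D)^k D` (a contraction: `T a − T b =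
−3(a − b)(a + b + a² + ab + b²)` with all iterates in `(D)`). [folklore] -/
theorem cubeIter_succ_sub (D s : R) :
    ∀ k : ℕ, ∃ r : R, cubeIter D s (k + 1) - cubeIter D s k = (3 * D) ^ k * D * r := by
  intro k
  induction k with
  | zero => exact ⟨s, by simp [cubeIter]⟩
  | succ k ih =>
    obtain ⟨r, hr⟩ := ih
    obtain ⟨w, hw⟩ := cubeIter_dvd D s k
    obtain ⟨w', hw'⟩ := cubeIter_dvd D s (k + 1)
    refine ⟨-(r * (w' + w + D * w' ^ 2 + D * w' * w + D * w ^ 2)), ?_⟩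
    have e : cubeIter D s (k + 2) - cubeIter D s (k + 1) =
        -3 * (cubeIter D s (k + 1) - cubeIter D s k) *
          (cubeIter D s (k + 1) + cubeIter D s k + cubeIter D s (k + 1) ^ 2 +
            cubeIter D s (k + 1) * cubeIter D s k + cubeIter D s k ^ 2) := by
      simp only [cubeIter]; ring
    rw [e, hr, hw, hw']; ring

/-- **Cube roots of `1 + 9Ds`**: if `(3D)^e ∈ I` then `1 + 9Ds` is a cube modulo `I`, namely
`(1 + 3z_e)³ ≡ 1 + 9Ds (mod I)` for the `e`-th iterate (`(1+3z)³ − (1+9Ds) = 9(z − T z)`).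
This replaces Hensel's lemma prime by prime (at the primes of `D` the number `3` is a unit, at
`λ ∣ 3` it is `λ²` up to a unit) by one global contraction in the `(3D)`-adic topology. [folklore] -/
theorem exists_pow_three_sub_mem_of_pow_mem (I : Ideal R) (D s : R) {e : ℕ} (he : (3 * D) ^ e ∈ I) :
    ∃ γ : R, γ ^ 3 - (1 + 9 * D * s) ∈ I := by
  obtain ⟨r, hr⟩ := cubeIter_succ_sub D s e
  refine ⟨1 + 3 * cubeIter D s e, ?_⟩
  have key : (1 + 3 * cubeIter D s e) ^ 3 - (1 + 9 * D * s) =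
      -9 * (cubeIter D s (e + 1) - cubeIter D s e) := by
    simp only [cubeIter]; ring
  rw [key, hr, show -9 * ((3 * D) ^ e * D * r) = (-9 * D * r) * (3 * D) ^ e by ring]
  exact I.mul_mem_left _ he

end CubeLemma

/-! ### Periodicity of the cubic residue symbol modulo `9D` -/

omit [NumberField K] in
include hζ in
/-- `K ∋ ζ₃` has no real embedding. [folklore] -/
theorem isEmpty_ringHom_real : IsEmpty (K →+* ℝ) := by
  refine ⟨fun φ ↦ ?_⟩
  have h := sq_add_self_add_one_eq_zero hζ
  have h' : ((ζ : 𝓞 K) : K) ^ 2 + (ζ : K) + 1 = 0 := by exact_mod_cast congrArg ((↑) : 𝓞 K → K) h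
  have hφ := congrArg φ h'
  rw [map_add, map_add, map_pow, map_one, map_zero] at hφ
  nlinarith [sq_nonneg (φ (ζ : K) + 1 / 2)]

/-- The Artin symbol of a map with values cubing to `1` cubes to `1`. [folklore] -/
theorem artinSymbol_pow_three_eq_one {G : Type*} [CommGroup G] {f : HeightOneSpectrum (𝓞 K) → G}
    (hf : ∀ v, f v ^ 3 = 1) (I : Ideal (𝓞 K)) : LFunctions.AbelianDensity.artinSymbol f I ^ 3 = 1 := by
  unfold LFunctions.AbelianDensity.artinSymbol
  by_cases hfin : (Function.mulSupport fun v : HeightOneSpectrum (𝓞 K) ↦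
      f v ^ (Associates.mk v.asIdeal).count (Associates.mk I).factors).Finite
  · rw [finprod_eq_prod _ hfin, ← Finset.prod_pow]
    refine Finset.prod_eq_one fun v _ ↦ ?_
    rw [← pow_mul, mul_comm, pow_mul, hf v, one_pow]
  · rw [finprod_of_infinite_mulSupport hfin, one_pow]

include hζ in
/-- **Periodicity of `(D/·)₃` modulo `9D`** (Artin reciprocity for `K(∛D)/K`, made explicit): for
nonzero `b, c ∈ 𝓞 K` with `c` prime to `3D` and `b ≡ c (mod 9D)`, the Artin symbols of `(b)` and
`(c)` for `v ↦ kummerChar(Frob_v)` (i.e. `∏_v e(χ_v(D))^{ord_v}`) agree. From the CFT modulus `𝔪`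
(all prime divisors contain `3D`, so `(3D)^e ∈ 𝔪` for some `e`) one passes to `9D` because
`b/c ≡ 1 + 9Ds` is a CUBE modulo `𝔪` (`exists_pow_three_sub_mem_of_pow_mem`) and the symbol of a cube
is `1`. [cite: Childress2009, Ch. 5 §2 Thm. 2.1] [cite: IrelandRosen1990, Ch. 9 §3 Theorem 1] -/
theorem artinSymbol_kummerChar_eq_of_sub_mem_span (hD : ∀ b : K, b ^ 3 ≠ (D : K)) (e : K →+* ℂ)
    [IsGalois K (kummerField D)] {b c : 𝓞 K} (hb : b ≠ 0) (hc : c ≠ 0)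
    (hcop : IsCoprime (Ideal.span {c}) (Ideal.span {3 * D}))
    (hbc : b - c ∈ Ideal.span {9 * D}) :
    LFunctions.AbelianDensity.artinSymbol (fun v ↦ kummerChar hζ hD e (galFrob K (kummerField D) v))
        (Ideal.span {b}) =
      LFunctions.AbelianDensity.artinSymbol (fun v ↦ kummerChar hζ hD e (galFrob K (kummerField D) v))
        (Ideal.span {c}) := by
  set f : HeightOneSpectrum (𝓞 K) → ℂˣ := fun v ↦ kummerChar hζ hD e (galFrob K (kummerField D) v)
    with hfdef
  obtain ⟨𝔪, h𝔪, hsupp, hAKR⟩ := exists_artinKillsRay_kummerChar hζ hD e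
  -- `(3D)^n ∈ 𝔪`
  have hrad : 3 * D ∈ 𝔪.radical := by
    rw [Ideal.radical_eq_sInf, Ideal.mem_sInf]
    rintro P ⟨hP, hPprime⟩
    have hP0 : P ≠ ⊥ := fun h0 ↦ h𝔪 (le_bot_iff.mp (h0 ▸ hP))
    set v : HeightOneSpectrum (𝓞 K) := ⟨P, hPprime, hP0⟩
    exact hsupp v hP
  obtain ⟨n, hn⟩ := hrad
  -- `c` (hence anything `≡ c` modulo a multiple of `3D`) is prime to `𝔪`
  have hcopM : ∀ x : 𝓞 K, x - c ∈ Ideal.span {3 * D} → IsCoprime (Ideal.span {x}) 𝔪 := by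
    intro x hx
    rw [Ideal.isCoprime_iff_sup_eq]
    by_contra hne
    obtain ⟨P, hPmax, hle⟩ := Ideal.exists_le_maximal _ hne
    have hP0 : P ≠ ⊥ := fun h0 ↦ h𝔪 (le_bot_iff.mp (h0 ▸ (le_sup_right.trans hle)))
    set v : HeightOneSpectrum (𝓞 K) := ⟨P, hPmax.isPrime, hP0⟩
    have h3D : 3 * D ∈ P := hsupp v (le_sup_right.trans hle)
    have hxP : x ∈ P := hle (Ideal.mem_sup_left (Ideal.mem_span_singleton_self x))
    have hcP : c ∈ P := by
      have : c = x - (x - c) := by ring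
      rw [this]
      exact P.sub_mem hxP ((Ideal.span_singleton_le_iff_mem _).mpr h3D hx)
    have htop : Ideal.span {c} ⊔ Ideal.span {3 * D} ≤ P :=
      sup_le ((Ideal.span_singleton_le_iff_mem _).mpr hcP) ((Ideal.span_singleton_le_iff_mem _).mpr h3D)
    rw [Ideal.isCoprime_iff_sup_eq.mp hcop] at htop
    exact hPmax.ne_top (top_le_iff.mp htop)
  have h9 : Ideal.span {9 * D} ≤ Ideal.span {(3 : 𝓞 K) * D} :=
    Ideal.span_singleton_le_span_singleton.mpr ⟨3, by ring⟩
  -- Bezout for `c`: `c c' ≡ 1 (mod 𝔪)`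
  obtain ⟨a, ha, m₀, hm₀, ham⟩ := Submodule.mem_sup.mp
    ((Ideal.isCoprime_iff_sup_eq.mp (hcopM c (by simp))).symm ▸ Submodule.mem_top :
      (1 : 𝓞 K) ∈ Ideal.span {c} ⊔ 𝔪)
  obtain ⟨c', rfl⟩ := Ideal.mem_span_singleton'.mp ha
  -- `b - c = 9 D t`
  obtain ⟨t, ht⟩ := Ideal.mem_span_singleton'.mp hbc
  -- the cube `γ³ ≡ 1 + 9 D (t c')`
  obtain ⟨γ, hγ⟩ := exists_pow_three_sub_mem_of_pow_mem 𝔪 D (t * c') hn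
  -- `b ≡ γ³ c (mod 𝔪)`
  have hbγ : b - γ ^ 3 * c ∈ 𝔪 := by
    have e1 : b - γ ^ 3 * c = -(γ ^ 3 - (1 + 9 * D * (t * c'))) * c + m₀ * (b - c) := by
      linear_combination (-(b - c)) * ham + (-(c' * c)) * ht
    rw [e1]
    exact 𝔪.add_mem (𝔪.mul_mem_right _ (𝔪.neg_mem hγ)) (𝔪.mul_mem_right _ hm₀)
  -- the degenerate case `𝔪 = ⊤`
  by_cases htop : 𝔪 = ⊤
  · subst htop
    exact hAKR b c hb hc (Ideal.isCoprime_iff_sup_eq.mpr (by simp)) Submodule.mem_top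
      fun φ ↦ ((isEmpty_ringHom_real hζ).false φ).elim
  -- coprimality is stable under congruence mod `𝔪`
  have hcong : ∀ x y : 𝓞 K, IsCoprime (Ideal.span {x}) 𝔪 → x - y ∈ 𝔪 → IsCoprime (Ideal.span {y}) 𝔪 := by
    intro x y hx hxy
    rw [Ideal.isCoprime_iff_sup_eq, eq_top_iff, ← Ideal.isCoprime_iff_sup_eq.mp hx]
    refine sup_le ((Ideal.span_singleton_le_iff_mem _).mpr ?_) le_sup_right
    have : x = y + (x - y) := by ring
    rw [this]
    exact Submodule.add_mem_sup (Ideal.mem_span_singleton_self y) hxy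
  have hbcop : IsCoprime (Ideal.span {b}) 𝔪 := hcopM b (h9 hbc)
  have hγc0 : γ ^ 3 * c ≠ 0 := by
    intro h0
    rw [h0, sub_zero] at hbγ
    apply htop
    rw [← Ideal.isCoprime_iff_sup_eq.mp hbcop]
    exact (sup_eq_right.mpr ((Ideal.span_singleton_le_iff_mem _).mpr hbγ)).symm
  have hγ0 : γ ≠ 0 := fun h ↦ hγc0 (by rw [h]; ring)
  -- Artin reciprocity: `S(b) = S(γ³ c) = S(γ)³ S(c) = S(c)`
  have h1 := hAKR b (γ ^ 3 * c) hb hγc0 (hcong b _ hbcop hbγ) hbγ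
    fun φ ↦ ((isEmpty_ringHom_real hζ).false φ).elim
  rw [h1, show Ideal.span {γ ^ 3 * c} = Ideal.span {γ} * Ideal.span {γ} * Ideal.span {γ} * Ideal.span {c} by
    rw [Ideal.span_singleton_mul_span_singleton, Ideal.span_singleton_mul_span_singleton,
      Ideal.span_singleton_mul_span_singleton]; ring_nf]
  have hγI : Ideal.span {γ} ≠ ⊥ := by rwa [Ne, Ideal.span_singleton_eq_bot]
  have hcI : Ideal.span {c} ≠ ⊥ := by rwa [Ne, Ideal.span_singleton_eq_bot]
  rw [LFunctions.AbelianDensity.artinSymbol_mul f (mul_ne_zero (mul_ne_zero hγI hγI) hγI) hcI,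
    LFunctions.AbelianDensity.artinSymbol_mul f (mul_ne_zero hγI hγI) hγI,
    LFunctions.AbelianDensity.artinSymbol_mul f hγI hγI]
  have h3 := artinSymbol_pow_three_eq_one (f := f) (fun v ↦ kummerChar_pow_three hζ hD e _)
    (Ideal.span {γ})
  rw [← pow_three', h3, one_mul]

/-- **The value of the symbol at a prime `v ∤ 3D`** is `e(χ_v(D))` (`artinSymbol_asIdeal` and
`kummerChar_galFrob`). [cite: IrelandRosen1990, Ch. 9 §3 Prop. 9.3.2] -/
theorem artinSymbol_kummerChar_asIdeal (hD : ∀ b : K, b ^ 3 ≠ (D : K)) (e : K →+* ℂ)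
    [IsGalois K (kummerField D)] (v : HeightOneSpectrum (𝓞 K)) (hDv : D ∉ v.asIdeal)
    (h3v : (3 : 𝓞 K) ∉ v.asIdeal) :
    ((LFunctions.AbelianDensity.artinSymbol (fun w ↦ kummerChar hζ hD e (galFrob K (kummerField D) w))
        v.asIdeal : ℂˣ) : ℂ) = e (cubicResidueSymbol v (Ideal.Quotient.mk v.asIdeal D) : K) := by
  rw [LFunctions.AbelianDensity.artinSymbol_asIdeal]
  exact kummerChar_galFrob hζ hD e v hDv h3v

include hζ in
/-- **The cube case**: if `D = b³` with `b ∈ K` then `χ_v(D) = 1` at every `v ∤ 3D` (`b` is integral,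
`χ_v(D) = χ_v(b)³`). [cite: IrelandRosen1990, Ch. 9 §3 Prop. 9.3.3] -/
theorem cubicResidueSymbol_eq_one_of_cube {b : K} (hb : b ^ 3 = (D : K)) (v : HeightOneSpectrum (𝓞 K))
    (hDv : D ∉ v.asIdeal) (h3v : (3 : 𝓞 K) ∉ v.asIdeal) :
    cubicResidueSymbol v (Ideal.Quotient.mk v.asIdeal D) = 1 := by
  have hbint : IsIntegral ℤ b := IsIntegral.of_pow (by norm_num : 0 < 3) (hb ▸ RingOfIntegers.isIntegral_coe D)
  set b' : 𝓞 K := ⟨b, hbint⟩ with hb'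
  have hD : D = b' ^ 3 := by
    apply RingOfIntegers.ext
    rw [hb']
    push_cast
    exact hb.symm
  letI := Ideal.Quotient.field v.asIdeal
  have hb0 : Ideal.Quotient.mk v.asIdeal b' ≠ 0 := by
    intro h0
    apply hDv
    rw [hD]
    exact v.asIdeal.pow_mem_of_mem ((Ideal.Quotient.eq_zero_iff_mem).mp h0) 3 (by norm_num)
  rw [hD, map_pow, ← cubicResidueChar_apply hζ h3v, map_pow, cubicResidueChar_apply]
  exact (cubicResidueSymbol_spec hζ h3v hb0).1

end Kummer

end Literature.NumberTheory.GaloisRepresentations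

end
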